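import Mathlib
import HarnessLib
import HarnessLib.Audit
import Summits.RiemannHypothesis.Statement
import Literature.NumberTheory.LFunctions.RiemannXi
import HarnessLib.Audit.Status.Attr

/-!
Route: DeBrangesShift

# Route DeBrangesShift — de Branges' positivity at a free scale: the shift family E_c(z) = ξ(1/2 + c
− 2icz) put to the Conrey–Li kernel test at every c (idea card
`debranges-shift-family-fails-every-scale`; NEGATIVE-SIDE route)

**Thesis X (words).** It suffices to show: for SOME scale c ≥ 1/2, de Branges' positivity axiom
(3.1) holds for the de Branges space H(E_c) of the structure function E_c(z) = ξ(1/2 + c − 2icz) (ξ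
= `Literature.NumberTheory.LFunctions.riemannXi`; this is Lagarias' E_h, h = c, rescaled so that
E_c♯(z) = E_c(z − i) by ξ(s) = ξ(1 − s)): Re ⟨F(z), F(z+i)⟩ ≥ 0 for every F ∈ H(E_c) with F(z+i) ∈
H(E_c), where ⟨F, G⟩ = ∫_ℝ F(x) conj G(x) |E_c(x)|⁻² dx. For c ≥ 1/2 every hypothesis of de Branges'
Theorem 1 [ConreyLi2000 Thm 1; deBranges1986] holds UNCONDITIONALLY (E_c has no real zeros since ζ ≠
0 on Re s ≥ 1; |E_c(z̄)| < |E_c(z)| on Im z > 0 by Lagarias2005 Lemma 2.1/6.1; E_c♯ = E_c(· − i);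
|E_c(x+iy)| increasing in y > 0), and its first conclusion "all zeros of E_c lie on Im z = −1/2" is
RH verbatim (a zero ρ of ξ sits at w with Im w = −1/2 + (Re ρ − 1/2)/(2c)). c = 1/2 is de Branges'
own E = ξ(1 − iz) [deBranges1986]; the family ω ≥ 1/2 is de Branges' [deBranges1992; Suzuki2012
§1.8].

**X (Lean; decl `ShiftPositivity`, elaborated in the planner's Sketch.lean, lean check rc 0).**
H(E)-membership is transcribed from ConreyLi2000 §2 eq. (2.1) (F entire, F/E ∈ L²(ℝ), |F(z)|² ≤ ‖F‖²
K(z,z) with K(z,z) = (|E(z)|² − |E(z̄)|²)/(4π Im z), imposed for Im z ≠ 0) and inlined with `let`: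
`∃ c : ℝ, 1/2 ≤ c ∧ let E := fun z => riemannXi (1/2 + c − 2*c*I*z); let Mem := fun F =>
Differentiable ℂ F ∧ Integrable (fun x : ℝ => ‖F x / E x‖^2) ∧ ∀ z, z.im ≠ 0 → ‖F z‖^2 ≤ (∫ x : ℝ,
‖F x / E x‖^2) * ((‖E z‖^2 − ‖E (conj z)‖^2) / (4 * π * z.im)); ∀ F, Mem F → Mem (fun z => F (z +
I)) → 0 ≤ (∫ x : ℝ, F x * conj (F (x + I)) / (‖E x‖:ℂ)^2).re`.

**Assembly.** `ShiftPositivity → Summit.RiemannHypothesis` — de Branges/Conrey–Li Theorem 1 (first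
conclusion) transported by z ↦ 2cz; needs the reproducing-kernel identity of H(E) (ConreyLi2000
(2.2)–(2.5)); fact-backable.

**Expected outcome, stated up front.** This is the card's NEGATIVE-SIDE route. Conrey–Li refuted
(3.1) at c = 1/2 only, through the KERNEL TEST — (3.1) evaluated on the reproducing kernel at a
zero: N_c(ρ) := Re{conj ξ′(ρ) · ξ(ρ + 2c)} ≥ 0 at every zero ρ of ξ (K_c(w, w+i) = (c/π) conj ξ′(ρ)
ξ(ρ+2c)) — which fails at zero 34 (in tree, PROVED by a kernel-checked interval certificate:
`Literature.Barriers.RiemannHypothesis.ConreyLi2000_HE_holds`); no other scale is treated in print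
[Lagarias2005 §7; Suzuki2012 §1.8]. The cruxes are the necessary conditions the line needs at SOME
scale; the card's phase-rotation law (Γ-drift πc/2 plus the phase change of ζ across [ρ, ρ+2c],
governed by zero spacing / S(t)) predicts each is FALSE at EVERY scale. Refutations land as theorems
¬Crux in Theorems/ and are indexed by `ledger negatives`: they close de Branges' whole shift family
and extend the catalogued barrier `DeBrangesPositivity` from c = 1/2 to all c. A crux that survives
serious refutation would, against expectation, single out a live scale for de Branges' programme —
informative either way.

Rationale: WHY THIS LINE. de Branges' Hilbert-space programme is the one operator-theoretic RH strategy with a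
precise printed sufficient condition (axiom (3.1) ⟹ zeros of E on a line), proposed for E = ξ(1−iz)
[deBranges1986] and for the whole family H(E_ω), ω ≥ 1/2 [deBranges1992; deBranges1994; Suzuki2012
§1.8]; the catalogue records its death at ONE scale (ConreyLi2000: kernel test at zero 34, c = 1/2;
PROVED in tree) and print treats no other [Lagarias2005 §7]. The card supplies a mechanism for all
scales: at a simple critical zero ρ_n = 1/2+iγ_n one has N_c(ρ_n) = −Ξ′(γ_n)·Im ξ(1/2+2c+iγ_n), and
by Stirling arg ξ(1/2+2c+it) = π + ϑ(t) + πc/2 + arg ζ(1/2+2c+it) + O_c(1/t), so for c > 1/4 the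
kernel test at ρ_n reads  sin(πc/2 + arg ζ(1/2+2c+iγ_n) − πS(γ_n⁺)) ≤ 0,  i.e. S(γ_n⁺) − c/2 −
ε_n(c) mod 2 ∈ [0,1] with |ε_n(c)| ≤ log ζ(1/2+2c)/π (planner's derivation and check, NOTES.md: at c
= 1/2, zero 34 has S(γ₃₄⁺) = 34 − 1 − ϑ(γ₃₄)/π ≈ 0.047 and arg ζ(3/2+iγ₃₄) ≈ −0.57 (prime sum to p =
23), so its pass-arc is ≈ [0.07, 1.07] ∌ 0.047: it fails by ≈ 0.02 — Conrey–Li's 'barely negative'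
−5.4·10⁻⁶⁹; zero 1, S(γ₁⁺) ≈ 0.55, passes). The test is thus a Gram-type sign law for S(t) AT THE
ZEROS, and the refutation engines are imported from three areas: value distribution of S(t) /
Gram-law failures (Titchmarsh, Selberg, TrudgianGram2011; barrier GramRosserFailures is the
template: a universal sign rule would confine S), zero-spacing statistics for c ≤ 1/4 where arg ζ on
σ = 1/2+2c ≤ 1 is itself unbounded (the card's near-field / small-gap law; RodgersTao2020,
BuiEtAl2023), and kernel-checked interval arithmetic (the tree's DeBrangesPositivityHE/Cert
pipeline) for fixed scales. No new objects are posited; H(E) membership is inlined from ConreyLi2000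
(2.1).

RANKED CRUXES (all EXPECTED FALSE — the wanted theorems are the negations; each is the necessary
condition the line needs at some scale).
#2 KernelTestSomeScale: ∃ c ≥ 1/2 passing the kernel test at every zero. Hardest/most informative:
its negation "every c ≥ 1/2 fails at some zero" cannot be certified with finitely many zeros
(Kronecker: for c → ∞ the Γ-phase (γ_k/2)·log c of any finite zero set recurs to all-pass
configurations), so it needs a value-distribution theorem for S(γ⁺) mod 2 at heights ≫ c, plus
interval-in-c certificates on compact ranges.
#3 KernelTestSmallScale: ∃ c ∈ (0,1/2) passing at every CRITICAL zero (Lagarias' h < 1/2, de Branges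
functions only under RH; outside the assembly, filed as the sharpest negative knowledge). Card's
height law: failures need an uncompensated gap ≲ πc² and start near height e^{2u/c²}; predicted
witness γ₆₇₀₉ ≈ 7005.06 (Lehmer pair, gap 0.04) for all c ∈ [0.12, 0.5]; tiny c is out of certified
reach, so a uniform refutation needs small gaps at all heights (pair-correlation circle).
#4 RatioTestSomeScale: ∃ c > 0 with Re ξ(s+2c)/ξ(s) ≥ 0 on Re s > 1/2 (necessary condition of de
Branges' Theorem 2 for W_c = 1/E_c; (3.3) at any scale would give ζ ≠ 0 on Re s > 1/2). Sarnak's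
remark transports to every c (Bohr–Courant/Kronecker on a line 1/2 < σ < 1 with σ+2c > 1; in tree
for 2c = 1 as ConreyLi2000_FW_holds, Γ-free double-shift trick; general c needs Stirling phase
control, in tree). Cheap; closes the Theorem-2 branch at all scales.
#5 KernelTestQuarter: the c = 1/4 instance at critical zeros — the Σ₁ test of the card's
quantitative law (predicted first failure at or before γ₆₇₀₉); one certificate refutes it; if no
failure is found below 7010 the card's height law is wrong (kill criterion for the CARD, not the
route).
Target #0 ShiftPositivity and Assembly #1 (de Branges Thm 1 transported) frame the line; support:
KernelNecessity (ShiftPositivity at c ⟹ kernel test at c: ConreyLi2000 Thm 1 second conclusion,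
K_c(w,w+i) = (c/π)·conj ξ′(ρ)·ξ(ρ+2c); makes ¬#2 ⟹ ¬Target) and KernelTestOne (c = 1 calibration:
drift π/2, failures expected among the first zeros).

KILL / CLOSE CRITERIA. (a) #2 refuted (with KernelNecessity) ⟹ Target refuted, Assembly vacuous:
close `refuted` with census "de Branges (3.1) fails for every E_c, c ≥ 1/2" and ask the librarian to
widen DeBrangesPositivity's scope_caveat; (b) #3, #4 refuted ⟹ same for Lagarias' small shifts and
the 𝓕(W) branch; (c) a crux CHECKED and unrefuted after two refuter passes with certified search to
height 10⁴ ⟹ re-rank it up and open a positive sub-line at that scale; (d) #5 holding below height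
7010 retires the card's height law (route continues on #2/#4).
NOT DECOMPOSED YET. No phase-identity / Stirling-drift lemmas as items (provers attach them with
--supports), no certificate format, no S(t)-distribution sub-statements, no Dirichlet-L analogues
(ConreyLi2000 §3.2), no Suzuki/Burnol-type weaker positivities (explicitly outside this route: they
do not imply the kernel test).

Novelty: NOVELTY. Nearest prior art: ConreyLi2000 (c = 1/2 only: kernel test fails at zero 34; ratio test
fails by Sarnak's Bohr remark) and deBranges1992 (the family ω ≥ 1/2 itself). Delta: (i) the route
puts the WHOLE shift family c > 0 to both Conrey–Li tests, with typed statements at every scale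
(none in print for c ≠ 1/2); (ii) a mechanism not found anywhere searched: for c > 1/4 the kernel
test at a simple critical zero is the Gram-type law S(γ⁺) − c/2 − arg ζ(1/2+2c+iγ)/π mod 2 ∈ [0,1]
(drift πc/2 from Stirling), which explains the failure at zero 34 (a late zero: S(γ₃₄⁺) ≈ 0.05 <
1/4) at c = 1/2 and reduces 'every scale fails' to the value distribution of S(t) at zeros; for c ≤
1/4 the card's zero-spacing (near-field) law; (iii) the Kronecker caveat (no finite zero set refutes
all large c) that shapes crux #2. Expected grade: new-combination (ingredients — Hadamard/Stirling
phase bookkeeping, S(t) and Gram-law failure theory, Bohr–Kronecker density, certified ζ-numerics —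
are standard; their use to close de Branges' family at every scale is not in the literature found).
SEARCHED ( 2026-08-15: zbMATH 'de Branges space positivity condition Riemann zeta shifted xi Conrey
Li' (2 hits: ConreyLi2000 = doi:10.1155/S1073792800000489 = arXiv:math/9812166, Lagarias2006), 'de
Branges Hilbert space entire functions Riemann zeta positivity' (same 2), 'de Branges spaces zeta
Suzuki canonical system' (Suzuki2012 = arXiv:1204.1827), 'Li Xian-Jin Hilbert spaces entire
functions de Branges' (Co  [refs: 10.1155/S1073792800000489, 10.1006/jfan.1994.1046, math/9812166, 1204.1827, math/0601653, doi:10.1155/S1073792800000489, doi:10.1006/jfan.1994.1046, ConreyLi2000, Lagarias2006, Suzuki2012, Titchmarsh1986, Lagarias2005]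

Barriers (technique_class: de-Branges-positivity shift-family kernel-test Gram-law): BARRIERS (technique_class: de-Branges-positivity shift-family kernel-test Gram-law; catalogue
Literature/Barriers/RiemannHypothesis/* read 2026-08-15, 24 entries):
- Literature.Barriers.RiemannHypothesis.DeBrangesPositivity: APPLIES HEAD-ON and is the point — the
route sits inside this technique class on purpose. The barrier (ConreyLi2000_HE ∧ ConreyLi2000_FW,
both proved in tree) kills (3.1)/(3.3) at the single scale E = ξ(1−iz) (c = 1/2); its scope_caveat
leaves every other member of de Branges' own family H(E_ω), ω ≥ 1/2 [deBranges1992] and Lagarias'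
E_h, 0 < h < 1/2, formally open. No evasion is claimed: the thesis X is expected to be FALSE, and
the route's deliverable is the barrier's extension to all scales (refuted cruxes → `ledger
negatives`; librarian to widen scope_caveat/evasions_known). Honest residual: positivities strictly
weaker than the pointwise kernel test — Suzuki's Hamiltonian/screw-function positivity (Suzuki2012,
Suzuki2023; RH-equivalent), Burnol's spaces, Li's examples (Li2000) — are NOT touched by any crux
here and remain admissible for other routes.
- Literature.Barriers.RiemannHypothesis.BohrDenseValues: USED, not evaded — Bohr–Courant density /
Kronecker prime phases on lines 1/2 < σ ≤ 1 (in-tree facts BohrCourant1914_dense,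
Voronin1975_universality; the Γ-free argument of DeBrangesPositivityProofs) is exactly the engine
expected to refute crux #4 (ratio test) at every scale.
- Literature.Barriers.RiemannHypothesis.GramRosserFailures: ALLIED TEMPLA

History (route lifecycle, newest last):
- 2026-08-16T04:16:19Z · AUTO-CRUX (backfill): ShiftPositivity — hypotheses of the deciding theorem that nothing in the route derives are cruxes (operator:999:1085951)
- 2026-08-23T14:26:56Z · DORMANT — reconciler: no traction for 6.1 d (last activity item-evidence-added at 2026-08-17T11:17:47Z); parked, not closed — `ledger route dormant route-RiemannHypothesi (operator:999:497525)
- 2026-08-26T05:05:57Z · REACTIVATED — reconciler: reactivated — activity item-evidence-added at 2026-08-26T04:07:31Z after parking at 2026-08-23T14:26:56Z (operator:999:2075414)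
- 2026-08-29T03:02:17Z · BROKEN — KernelTestOne (stmt-RiemannHypothesis-1524, support) refuted by Summit.RiemannHypothesis.RiemannHypothesis.Theorems.DeBrangesShiftKernelTestOne_refuted (refuter-bsd-print-cf2-ref-g12-0)
- 2026-08-31T22:06:22Z · rev 3: dropped KernelTestOne — support outside the closes cone; refuted by DeBrangesShiftKernelTestOne_refuted (21-frontier DECISION 57ci 2026-08-31T22:05Z; column stays OPEN/dormant) (operator:999:2659672)
- 2026-08-31T22:06:22Z · REPAIRED (drop KernelTestOne) — back to open: support outside the closes cone; refuted by DeBrangesShiftKernelTestOne_refuted (21-frontier DECISION 57ci 2026-08-31T22:05Z; column stays OPEN/dormant) (operator:999:2659672)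

sub-problem: RiemannHypothesis · status: open · opened planner-plancard-RiemannHypothesis-RiemannHyp-2fecbd8d-0 2026-08-15T10:57:10Z · rev 3 · ledger route-RiemannHypothesis-DeBrangesShift
GENERATED by the gate from the ledger (D-0016/17). Provers cite these decls: `theorem foo : Summit.RiemannHypothesis.RiemannHypothesis.Theses.DeBrangesShift.<Decl> := …` in Summits/RiemannHypothesis/RiemannHypothesis/Theorems/<Name>.lean.
-/

namespace Summit.RiemannHypothesis.RiemannHypothesis.Theses.DeBrangesShift

open scoped BigOperators Topology Manifold Classical MeasureTheory ProbabilityTheory Matrix InnerProductSpace ComplexConjugate ContinuousMap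
open Filter Set Function TopologicalSpace MeasureTheory

attribute [summit_statement] _root_.Summit.RiemannHypothesis

open Summit

/-! Retired items kept as plain definitions (history; not obligations of this route): landed proofs / closed glue still name them. -/

-- tombstone: stmt-RiemannHypothesis-1524 was DROPPED from this route but is still named by active items / landed proofs — kept as a plain def (no route_item tag), not an obligation of this route
/-- retired stmt-RiemannHypothesis-1524 (dropped, gen None) — refuted by Summit.RiemannHypothesis.RiemannHypothesis.Theorems.DeBrangesShiftKernelTestOne_refuted. -/
def KernelTestOne : Prop :=
  ∀ ρ : ℂ, Literature.NumberTheory.LFunctions.riemannXi ρ = 0 → 0 ≤ (starRingEnd ℂ (deriv Literature.NumberTheory.LFunctions.riemannXi ρ) * Literature.NumberTheory.LFunctions.riemannXi (ρ + 2)).re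

/-- item stmt-RiemannHypothesis-1517 · crux (kind.auto-crux: conjecture-grade) · rank 0 · open · by planner
why it might fail: EXPECTED FALSE: c=1/2 is refuted (ConreyLi2000 (3.2); ConreyLi2000_HE_holds) and floats (kit j001544) fail the kernel test by zero 34 for each scanned c∈{1/2,3/4,1,3/2,2,3} (first n=34,9,4,1,1,1); with KernelNecessity each scale dies by one certificate; only the ∀c closure (crux #2) is hard.
sources: ConreyLi2000, arXiv:math/9812166, deBranges1986, deBranges1992, Lagarias2005, arXiv:math/0601653
[target] Thesis X of route DeBrangesShift: for some scale c ≥ 1/2, de Branges' axiom (3.1) holds for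
H(E_c), E_c(z) = ξ(1/2 + c − 2icz): Re⟨F, F(·+i)⟩ ≥ 0 whenever F and F(·+i) lie in H(E_c), ⟨F,G⟩ = ∫
F conj G /|E_c|². `Mem` transcribes ConreyLi2000 §2 eq. (2.1) (F entire, F/E ∈ L²(ℝ), |F(z)|² ≤ ‖F‖²
K(z,z), K(z,z) = (|E(z)|² − |E(z̄)|²)/(4π Im z), imposed for Im z ≠ 0; grounder: confirm the
equivalence with de Branges 1968 §19, 'F/E and F♯/E of bounded type and non-positive mean type in
the upper half-plane'). c = 1/2 is de Branges' E = ξ(1−iz) [deBranges1986], refuted by ConreyLi2000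
(3.2); the family ω ≥ 1/2 is de Branges' [deBranges1992; Suzuki2012 §1.8]. EXPECTED FALSE at every
scale (negative-side route): KernelNecessity and ¬KernelTestSomeScale give ¬ShiftPositivity. -/
@[route_item "route-RiemannHypothesis-DeBrangesShift", crux]
def ShiftPositivity : Prop :=
  ∃ c : ℝ, 1 / 2 ≤ c ∧ let E : ℂ → ℂ := fun z => Literature.NumberTheory.LFunctions.riemannXi (1 / 2 + c - 2 * c * Complex.I * z); let Mem : (ℂ → ℂ) → Prop := fun F => Differentiable ℂ F ∧ MeasureTheory.Integrable (fun x : ℝ => ‖F x / E x‖ ^ 2) ∧ ∀ z : ℂ, z.im ≠ 0 → ‖F z‖ ^ 2 ≤ (∫ x : ℝ, ‖F x / E x‖ ^ 2) * ((‖E z‖ ^ 2 - ‖E (starRingEnd ℂ z)‖ ^ 2) / (4 * Real.pi * z.im)); ∀ F : ℂ → ℂ, Mem F → Mem (fun z => F (z + Complex.I)) → 0 ≤ (∫ x : ℝ, F x * starRingEnd ℂ (F (x + Complex.I)) / ((‖E x‖ : ℂ) ^ 2)).re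

/-- item stmt-RiemannHypothesis-1518 · crux · rank 2 · open · by planner
why it might fail: Refuting needs a failing zero for EVERY c≥1/2: floats (kit j001544) fail first at n=34,9,4,1 for c=1/2,3/4,1,3/2, but no finite zero set covers all c (phases recur in c; drift πc/2≡0 mod 2π near c∈4ℕ leaves only zeros with S(γ⁺) mod 2∈[1,2)) — needs an S-at-zeros confinement theorem not in print.
sources: ConreyLi2000, arXiv:math/9812166, deBranges1992, Lagarias2005, Selberg1946, Tsang1986
[crux] EXPECTED FALSE — negative-side route; the WANTED theorem is the negation: ∀ c ≥ 1/2 ∃ zero ρ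
of ξ with Re{conj ξ′(ρ)·ξ(ρ+2c)} < 0. Conrey–Li's kernel test — axiom (3.1) on the reproducing
kernel K_c(w,·) at a zero w of E_c, K_c(w,w+i) = (c/π)·conj ξ′(ρ)·ξ(ρ+2c), ρ = 1/2+c−2icw
(ConreyLi2000 Thm 1, 2nd conclusion, transported) — passing at EVERY zero for SOME c ≥ 1/2; c = 1/2
fails at zero 34 (ConreyLi2000_HE_holds). Planner's form (NOTES.md): at a simple isolated critical
zero, N_c(ρ_n) = −Ξ′(γ_n)·Im ξ(1/2+2c+iγ_n); for c > 1/4 (Stirling drift πc/2) pass ⟺ sin(πc/2 + arg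
ζ(1/2+2c+iγ_n) − πS(γ_n⁺)) ≤ 0 ⟺ S(γ_n⁺) − c/2 − ε_n(c) mod 2 ∈ [0,1], |ε_n(c)| ≤ log ζ(1/2+2c)/π: a
Gram-type sign law for S(t) at the zeros (hand check in the rationale: zero 34 fails by 0.02 at c =
1/2). Engines: interval certificates per scale / compact c-range (support KernelTestFirstOctave,
KernelTestOne); for all large c a value-distribution theorem for S(γ⁺) mod 2 at heights ≫ c
(Kronecker caveat: any FINITE zero set passes again at arbitrarily large c, the Γ-phase of zero k
rotating like (γ_k/2)·log c); template: Gram-law failures (TrudgianGram2011). Multiple zeros pass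
trivially: harmless. -/
@[route_item "route-RiemannHypothesis-DeBrangesShift"]
def KernelTestSomeScale : Prop :=
  ∃ c : ℝ, 1 / 2 ≤ c ∧ ∀ ρ : ℂ, Literature.NumberTheory.LFunctions.riemannXi ρ = 0 → 0 ≤ (starRingEnd ℂ (deriv Literature.NumberTheory.LFunctions.riemannXi ρ) * Literature.NumberTheory.LFunctions.riemannXi (ρ + 2 * c)).re

/-- item stmt-RiemannHypothesis-1519 · crux · rank 3 · open · by planner
why it might fail: Small c: leading term 2c|ξ′(ρ)|²>0, failures need very late zeros or uncompensated gaps ≲πc²; floats (kit j001544): c=1/4 first fails at zero 922 (γ≈1329), c=1/8 passes all 1500 scanned zeros and the Lehmer pair (γ₆₇₀₉ passes for c≤1/4); the ∀c→0 negation needs a zero-spacing/S theorem.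
sources: Lagarias2005, arXiv:math/0601653, ConreyLi2000, RodgersTao2020, BuiEtAl2023, Selberg1946
[crux] EXPECTED FALSE — wanted: ∀ c ∈ (0,1/2) ∃ critical zero ρ with Re{conj ξ′(ρ)·ξ(ρ+2c)} < 0.
Lagarias' small shifts E_h, 0 < h < 1/2, are de Branges functions only under RH (Lagarias2005 Lemma
2.1(2), §7; Suzuki2012 §1.2), so this range is OUTSIDE the assembly; filed as the card's novel
regime and the sharpest negative knowledge on the family; restricted to critical zeros so that it is
meaningful unconditionally. Card's mechanism: N_c(ρ_n) = |ξ′(ρ_n)|·|ξ(ρ_n+2c)|·cos R_c, R_c = drift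
πc/2 + signed near field Σ ±arctan(2c/|γ_n − γ′|) + far field; for 2c ≤ 1/2 the abscissa 1/2+2c lies
in the strip, arg ζ there is unbounded, and failures are driven by zero spacing: an uncompensated
gap ≲ πc² just above γ_n suffices; predicted witness for every c ∈ [0.12, 0.5]: the lower Lehmer
zero γ₆₇₀₉ ≈ 7005.06 (gap 0.04); first failures near height e^{2u/c²}. A uniform refutation (c → 0)
needs small normalised gaps at all heights (pair correlation; liminf ≤ 0.5154 under RH, BuiEtAl2023;
Λ ≥ 0 circle, RodgersTao2020) AND control of the compensating near field (audit caveat: a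
sign-change lemma for R_c, not one small gap). Cheap partial wins: per-scale certificates (crux
KernelTestQuarter). -/
@[route_item "route-RiemannHypothesis-DeBrangesShift"]
def KernelTestSmallScale : Prop :=
  ∃ c : ℝ, 0 < c ∧ c < 1 / 2 ∧ ∀ ρ : ℂ, Literature.NumberTheory.LFunctions.riemannXi ρ = 0 → ρ.re = 1 / 2 → 0 ≤ (starRingEnd ℂ (deriv Literature.NumberTheory.LFunctions.riemannXi ρ) * Literature.NumberTheory.LFunctions.riemannXi (ρ + 2 * c)).re

/-- item stmt-RiemannHypothesis-1520 · support · rank 4 · open · by planner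
why it might fail: EXPECTED FALSE, routinely: Sarnak's Bohr argument (ConreyLi2000 §4) is shift-agnostic — on Re s=σ>1, Im log ζ(σ+it)−Im log ζ(σ+2c+it) is unbounded (Kronecker, Σ_p p⁻¹(1−p^{−2c})=∞) while the Γ_ℝ(s+2c)/Γ_ℝ(s) phase stays bounded (→πc/2, Stirling), so Re ξ(s+2c)/ξ(s)<0 somewhere for every c>0.
sources: ConreyLi2000, arXiv:math/9812166, Titchmarsh1986, BohrCourant1914, Steuding2007, Literature.Barriers.RiemannHypothesis.ConreyLi2000_FW
[crux] EXPECTED FALSE — wanted: ∀ c > 0 ∃ s₀, Re s₀ > 1/2, Re{ξ(s₀+2c)/ξ(s₀)} < 0. Necessary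
condition of de Branges' Theorem 2 (ConreyLi2000 Thm 2) for W_c = 1/E_c: W_c(z)/W_c(z+i) =
ξ(s+2c)/ξ(s), s = 1/2+c−2icz, Im z > −1/2 ⟺ Re s > 1/2; positivity (3.3) for 𝓕(W_c) at ANY scale
would make W_c analytic on Im z > −1/2, i.e. ζ ≠ 0 on Re s > 1/2. c = 1/2 is the barrier instance
ConreyLi2000_FW (Sarnak's remark; PROVED in tree, Γ-free through ξ(s)/ξ(s+2) and Kronecker prime
phases: DeBrangesPositivityProofs.lean). Transport to every c > 0: on Re s = σ ∈ (1/2,1) with σ+2c >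
1, Im log ζ(σ+it) is unbounded in both directions (Bohr–Courant; in tree: Kronecker + Σ1/p = ∞)
while arg ζ(s+2c) (abscissa > 1) and the phase of Γ_ℝ(s+2c)/Γ_ℝ(s) (→ πc/2; Stirling files under
Literature/Analysis/SpecialFunctions) stay bounded on the line; a sign-confined continuous log of
ξ(s+2c)/ξ(s) would bound Im log ζ — contradiction. Rational c = m/k: compose k shifts and Γ_ℝ(s+2) =
Γ_ℝ(s)s/(2π) m times to stay Γ-free as in the tree's proof; irrational c needs the Stirling phase
bound. Cheap; closes the Theorem-2 branch at all scales. -/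
@[route_item "route-RiemannHypothesis-DeBrangesShift"]
def RatioTestSomeScale : Prop :=
  ∃ c : ℝ, 0 < c ∧ ∀ s : ℂ, 1 / 2 < s.re → 0 ≤ (Literature.NumberTheory.LFunctions.riemannXi (s + 2 * c) / Literature.NumberTheory.LFunctions.riemannXi s).re

/-- item stmt-RiemannHypothesis-1521 · support · rank 5 · open · by planner
why it might fail: EXPECTED FALSE with a located float witness (kit j001544, mp.dps 30): at c=1/4 the kernel test first fails at zero n=922 (γ≈1329.0435, S(γ⁺)≈0.079, cosR≈−0.054), then n=996 (cosR≈−0.12), 1308 (−0.04), 1496 (γ≈1977.17, −0.28); one sign certificate refutes it.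
sources: ConreyLi2000, arXiv:math/9812166, Literature.Barriers.RiemannHypothesis.ConreyLi2000_HE, Edwards1974, Titchmarsh1986
[crux] EXPECTED FALSE — wanted: a certified critical zero ρ = 1/2+iγ with Re{conj ξ′(ρ)·ξ(1+iγ)} <
0, i.e. failure of the kernel test at c = 1/4 (shift 1/2, abscissa 1). Σ₁ face of the card's
quantitative law: predicted failure at the lower Lehmer zero γ₆₇₀₉ ≈ 7005.06 (for every c ∈
[0.12,0.5]); first failing index n(1/4) uncomputed (the card's mpmath script never ran). Planner's
form at a simple isolated critical zero: FAIL ⟺ (−1)^{N(γ)}·Im ξ(1+iγ) > 0. First step (kit,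
floats): scan n ≤ 10⁴ for the first failure. Refutation = one kernel-checked interval certificate in
the style of DeBrangesPositivityHE.lean (zero bracket by the twisted sign test, slope box for ζ′,
ζ(1+iγ) by zetaBoxK) plus a Stirling box for the Γ_ℝ-ratio (the reflection trick of the c = 1/2
proof no longer removes Γ; use Gamma_eq_mul_exp_stirlingPrim_horizontal as in
DeBrangesPositivityCert.lean). If NO failure exists below height 7010 the card's height law is wrong
(kill criterion for the card, not the route); the bounded positive statement (all ~6700 zeros
certified) is not wanted. -/
@[route_item "route-RiemannHypothesis-DeBrangesShift"]
def KernelTestQuarter : Prop :=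
  ∀ ρ : ℂ, Literature.NumberTheory.LFunctions.riemannXi ρ = 0 → ρ.re = 1 / 2 → 0 ≤ (starRingEnd ℂ (deriv Literature.NumberTheory.LFunctions.riemannXi ρ) * Literature.NumberTheory.LFunctions.riemannXi (ρ + 1 / 2)).re

/-- item stmt-RiemannHypothesis-1522 · support · rank 9 · open · by planner
sources: ConreyLi2000, Lagarias2005, deBranges1986
[support] Glue making crux #2 load-bearing: for every c ≥ 1/2, (3.1) for H(E_c) (the inlined
Mem/positivity of ShiftPositivity at that c) implies the kernel test at every zero of ξ —
ConreyLi2000 Thm 1, second conclusion, transported by z ↦ 2cz: for a zero w of E_c (ρ = 1/2+c−2icw),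
F = K_c(w,·) ∈ H(E_c) and F(·+i) ∈ H(E_c) by (2.3) (E_c has no real zeros — ζ ≠ 0 on Re s ≥ 1 —, is
Hermite–Biehler for c ≥ 1/2 by Lagarias2005 Lemma 2.1, and E_c♯ = E_c(·−i) by ξ(s) = ξ(1−s)), and Re
K_c(w,w+i) = Re⟨F(·+i),F⟩ ≥ 0 with K_c(w,w+i) = conj E_c′(w)·E_c(w+i)/(2πi) = (c/π)·conj
ξ′(ρ)·ξ(ρ+2c). Needs the reproducing-kernel identity (2.2) for the inlined Mem (Cauchy's formula in
both half-planes for F/E, F♯/E): real work but standard; may be fact-backed (de Branges 1968 Thms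
19–23 via a cite item). With ¬KernelTestSomeScale it yields ¬ShiftPositivity; EXPECTED to be the
route's closing move. -/
@[route_item "route-RiemannHypothesis-DeBrangesShift"]
def KernelNecessity : Prop :=
  ∀ c : ℝ, 1 / 2 ≤ c → (let E : ℂ → ℂ := fun z => Literature.NumberTheory.LFunctions.riemannXi (1 / 2 + c - 2 * c * Complex.I * z); let Mem : (ℂ → ℂ) → Prop := fun F => Differentiable ℂ F ∧ MeasureTheory.Integrable (fun x : ℝ => ‖F x / E x‖ ^ 2) ∧ ∀ z : ℂ, z.im ≠ 0 → ‖F z‖ ^ 2 ≤ (∫ x : ℝ, ‖F x / E x‖ ^ 2) * ((‖E z‖ ^ 2 - ‖E (starRingEnd ℂ z)‖ ^ 2) / (4 * Real.pi * z.im)); ∀ F : ℂ → ℂ, Mem F → Mem (fun z => F (z + Complex.I)) → 0 ≤ (∫ x : ℝ, F x * starRingEnd ℂ (F (x + Complex.I)) / ((‖E x‖ : ℂ) ^ 2)).re) → ∀ ρ : ℂ, Literature.NumberTheory.LFunctions.riemannXi ρ = 0 → 0 ≤ (starRingEnd ℂ (deriv Literature.NumberTheory.LFunctions.riemannXi ρ)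 * Literature.NumberTheory.LFunctions.riemannXi (ρ + 2 * c)).re

/-- item stmt-RiemannHypothesis-1523 · support · rank 9 · open · by planner
sources: ConreyLi2000, Literature.Barriers.RiemannHypothesis.ConreyLi2000_HE
[support] Compact-range face of crux #2, EXPECTED FALSE and closeable by finitely many certificates:
some c in the first octave [1/2, 1] of de Branges' family passes the kernel test at every zero.
Wanted theorem (the negation): for EVERY c ∈ [1/2,1] a zero of ξ with Re{conj ξ′(ρ)·ξ(ρ+2c)} < 0 —
by interval arithmetic in c as well as in γ: cover [1/2,1] by sub-intervals, each refuted by one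
certified zero (pass-arc for c is ≈ [c/2+ε, c/2+1+ε] in S(γ⁺) mod 2, so zeros with S(γ⁺) just below
c/2 — late zeros like #34 (S ≈ 0.047) for c near 1/2, ordinary zeros for larger c — are the
candidates; float scan first). This is the realistic near-term theorem 'de Branges (3.1) fails for
every E_c, 1/2 ≤ c ≤ 1' and the calibration of the c-uniform machinery that crux #2 needs on compact
ranges. -/
@[route_item "route-RiemannHypothesis-DeBrangesShift"]
def KernelTestFirstOctave : Prop :=
  ∃ c : ℝ, 1 / 2 ≤ c ∧ c ≤ 1 ∧ ∀ ρ : ℂ, Literature.NumberTheory.LFunctions.riemannXi ρ = 0 → 0 ≤ (starRingEnd ℂ (deriv Literature.NumberTheory.LFunctions.riemannXi ρ) * Literature.NumberTheory.LFunctions.riemannXi (ρ + 2 * c)).re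

/-- item stmt-RiemannHypothesis-1525 · assembly · rank 1 · open · by planner
sources: ConreyLi2000, deBranges1986, Lagarias2005
[assembly] ShiftPositivity → RiemannHypothesis: de Branges' Theorem 1 (ConreyLi2000 Thm 1,
'essentially due to de Branges'; deBranges1986) for E_c at the witnessing c ≥ 1/2 — hypotheses
unconditional: no real zeros (ζ ≠ 0 on Re s ≥ 1); Hermite–Biehler (Lagarias2005 Lemma 2.1/6.1, h ≥
1/2); E_c♯ = E_c(·−i) (functional equation + reflection); |E_c(x+iy)| increasing in y > 0 (∂_σ
log|ξ| = Σ_ρ (σ−β)/|s−ρ|² > 0 for σ ≥ 1; cf. RiemannXiShiftInequality) — first conclusion: every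
zero w of E_c has Im w = −1/2 = −1/2 + (Re ρ − 1/2)/(2c) for the zero ρ = 1/2+c−2icw of ξ, so all
zeros of ξ have Re ρ = 1/2, i.e. Mathlib's RiemannHypothesis (nontrivial zeta zeros = zeros of ξ:
riemannXi_eq_mul_completedRiemannZeta). The printed proof uses the reproducing-kernel structure of
H(E) (ConreyLi2000 (2.2)–(2.5): kernels, division by z−z₀ inside H(E), strict monotonicity);
discharge with a named fact over the inlined Mem or prove outright (substantial). EXPECTED MOOT:
once KernelTestSomeScale is refuted and KernelNecessity proved, the antecedent is false and the
implication is vacuous; the route then closes `refuted` with its census and DeBrangesPositivity is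
widened to all scales. -/
@[route_item "route-RiemannHypothesis-DeBrangesShift", crux]
def Assembly : Prop :=
  ShiftPositivity → Summit.RiemannHypothesis

-- records of items no longer active in this route (dropped / restated):
-- earlier KernelTestOne (stmt-RiemannHypothesis-1524, dropped 2026-08-31T22:06:22Z): refuted by Summit.RiemannHypothesis.RiemannHypothesis.Theorems.DeBrangesShiftKernelTestOne_refuted — ∀ ρ : ℂ, Literature.NumberTheory.LFunctions.riemannXi ρ = 0 → 0 ≤ (starRingEnd ℂ (deriv Literature.NumberTheory.LFunctions.riemannXi ρ) * Literature.NumberTheory.LFunctions.riemannXi (ρ + 2)).re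

/-! D-0027 §2.1 — DECIDING THEOREM (planner-authored via `route open/edit --closes-file`; by planner-rbadge-RiemannHypothesis-DeBrangesShif-380a5a29-g2-0 2026-08-15T16:15:35Z):
its hypotheses are this route's items and its conclusion the sub-problem Statement (glue_lint), and it elaborates with this file. -/

@[closes "route-RiemannHypothesis-DeBrangesShift"] theorem closes (hX : ShiftPositivity) (hA : Assembly) : _root_.Summit.RiemannHypothesis :=
  hA hX

end Summit.RiemannHypothesis.RiemannHypothesis.Theses.DeBrangesShift
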